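import Summits.CriticalPhenomena.PercolationContinuityZ3.Theorems.PercNearOneGluingNoHeavyLowerTailStarSetPairRowCertificate
import Summits.CriticalPhenomena.PercolationContinuityZ3.Theorems.PercNearOneGluingNoHeavyLowerTailStarSetClassForestComonotone
import HarnessLib

/-!
# `NoHeavyLowerTail` (stmt-CriticalPhenomena-4575) — the PAIR-ROW certificate, integrated (level `j ≤ 2`, any two-port star multigraph)

Support file (prover `prim-gen-swap` gen 9; `--supports stmt-CriticalPhenomena-4575`).  No definitions, no named facts, no sorries.

Integrates `StarSet.pairRow_certificate_pointwise` (…StarSetPairRowCertificate) against the product measure and discharges the pair rows by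
the lonelier-member inequality in the link-glued graphs (`StarSet.linkRow_le`, pushed forward to class patterns by
`StarSet.linkSum_pushforward`):

* `StarSet.pairRow_comonotone_budget` — for a multigraph of two-port pendant stars (classes with distinct port pairs), `c ∈ A` off the ports
  dominating the designated class ports, constants `C0 ≥ 0`, budget coefficients `b_t ≥ 0` with designated port sets `R_t`, and the
  supply hypotheses `hG0`, `hG1` of seat memo MWF-CERT.md §2:
  `0 ≤ C0 · Σ_S W(S)·[μ(c ↮_ξ P_S, |π_ξ(c)| ≤ j) − μ(c ↮_ξ P_S, 1 ≤ |π_ξ(P_S)| ≤ j)] + Σ_t b_t · Σ_S W(S)·μ(c ↮_ξ R_t ∪ P_S, |π_ξ(c)| ≤ j)`.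
The assembly into the observer-extension inequality is the sequel file …StarSetPairRowLevelTwo.
-/

noncomputable section

namespace Summit.CriticalPhenomena.PercolationContinuityZ3.Theorems

open MeasureTheory Set Literature.Probability.LatticeModels Literature.Probability.Percolation
open scoped Classical BigOperators

variable {n M : ℕ}

namespace StarSet

/-- A pattern sum of probabilities, as a finite weighted sum over the configurations. [folklore] -/
theorem linkSum_real_eq_sum {m : ℕ} (w : Sym2 (Fin n) → unitInterval) (W : Finset (Fin m) → ℝ)
    (D : Finset (Fin m) → Set (BondConfig (Fin n))) :
    ∑ σ ∈ (Finset.univ : Finset (Fin m)).powerset, W σ * (prodBernoulli w).real (D σ) =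
      ∑ ω : BondConfig (Fin n), BHK2006.weight (fun e => (w e : ℝ)) ω *
        ∑ σ ∈ (Finset.univ : Finset (Fin m)).powerset, W σ * DecisionTree.ind (D σ) ω := by
  have h := linkSum_real_sub_eq_sum w W D (fun _ => (∅ : Set (BondConfig (Fin n))))
  simp only [measureReal_empty, sub_zero] at h
  rw [h]
  refine Finset.sum_congr rfl fun ω _ => ?_
  congr 1
  refine Finset.sum_congr rfl fun σ _ => ?_
  rw [DecisionTree.ind_of_not_mem (Set.notMem_empty ω), sub_zero]

/-- **The pair-row certificate, integrated.**  See the file header.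
[cite: VandenbergHaggstromKahn2005, Thm. 1.5 (p. 7) — only through the domination hypothesis, via `StarSet.linkRow_le`; seat memo MWF-CERT.md §1–§2] -/
theorem pairRow_comonotone_budget {ι : Type*} [Fintype ι] (w : Sym2 (Fin n) → unitInterval) (A : Finset (Fin n)) {m : ℕ}
    (s p p' : Fin m → Fin n) (cls : Fin m → Fin M) (P P' : Fin M → Fin n) (hP : ∀ i, p i = P (cls i)) (hP' : ∀ i, p' i = P' (cls i))
    (c : Fin n) (j : ℕ) (hj : j ≤ 2) (hs : Function.Injective s) (hsA : ∀ i, s i ∉ A)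
    (hPA : ∀ I, P I ∈ A) (hP'A : ∀ I, P' I ∈ A) (hPP' : ∀ I, P I ≠ P' I)
    (hnopar : ∀ I K : Fin M, I ≠ K → ¬ ((P K = P I ∨ P K = P' I) ∧ (P' K = P I ∨ P' K = P' I)))
    (hcA : c ∈ A) (hcP : ∀ I, c ≠ P I ∧ c ≠ P' I)
    (hwjunk : ∀ i u, u ≠ s i → u ≠ p i → u ≠ p' i → w s(s i, u) = 0)
    (hdom : ∀ I, (prodBernoulli w).real {ω : BondConfig (Fin n) | (A.filter fun z => ω ∈ openConn (P I) z).card ≤ j} ≤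
      (prodBernoulli w).real {ω : BondConfig (Fin n) | (A.filter fun z => ω ∈ openConn c z).card ≤ j})
    (C0 : ℝ) (hC0 : 0 ≤ C0) (b : ι → ℝ) (hb : ∀ t, 0 ≤ b t) (R : ι → Finset (Fin n))
    (hRport : ∀ t, ∀ u ∈ R t, ∃ I, u = P I ∨ u = P' I)
    (hG0 : C0 * ∑ K, ((1 - ∏ i ∈ Finset.univ.filter (fun i => cls i = K), (1 - (w s(s i, p i) : ℝ) * w s(s i, p' i))) *
        ∏ K' ∈ Finset.univ.filter (fun K' => ¬ (P K' = P K ∨ P K' = P' K ∨ P' K' = P K ∨ P' K' = P' K)),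
          ∏ i ∈ Finset.univ.filter (fun i => cls i = K'), (1 - (w s(s i, p i) : ℝ) * w s(s i, p' i))) ≤ C0 + ∑ t, b t)
    (hG1 : ∀ r, C0 * ∑ K ∈ Finset.univ.filter (fun K => P K ≠ r ∧ P' K ≠ r),
        ((1 - ∏ i ∈ Finset.univ.filter (fun i => cls i = K), (1 - (w s(s i, p i) : ℝ) * w s(s i, p' i))) *
        ∏ K' ∈ Finset.univ.filter (fun K' => ¬ (P K' = P K ∨ P K' = P' K ∨ P' K' = P K ∨ P' K' = P' K)),
          ∏ i ∈ Finset.univ.filter (fun i => cls i = K'), (1 - (w s(s i, p i) : ℝ) * w s(s i, p' i))) ≤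
        C0 + ∑ t ∈ Finset.univ.filter (fun t => r ∉ R t), b t) :
    0 ≤ C0 * ∑ S ∈ (Finset.univ : Finset (Fin M)).powerset,
        ((∏ K ∈ S, (1 - ∏ i ∈ Finset.univ.filter (fun i => cls i = K), (1 - (w s(s i, p i) : ℝ) * w s(s i, p' i)))) *
          ∏ K ∈ Finset.univ \ S, ∏ i ∈ Finset.univ.filter (fun i => cls i = K), (1 - (w s(s i, p i) : ℝ) * w s(s i, p' i))) *
        ((prodBernoulli w).real {ω : BondConfig (Fin n) |
            (∀ u ∈ S.image P ∪ S.image P', ¬ (openGraph (ω ∩ {e | ∀ v ∈ Finset.univ.image s, v ∉ e})).Reachable c u) ∧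
            (A.filter fun z => (openGraph (ω ∩ {e | ∀ v ∈ Finset.univ.image s, v ∉ e})).Reachable c z).card ≤ j} -
          (prodBernoulli w).real {ω : BondConfig (Fin n) |
            (∀ u ∈ S.image P ∪ S.image P', ¬ (openGraph (ω ∩ {e | ∀ v ∈ Finset.univ.image s, v ∉ e})).Reachable c u) ∧
            1 ≤ (A.filter fun z => ∃ u ∈ S.image P ∪ S.image P',
              (openGraph (ω ∩ {e | ∀ v ∈ Finset.univ.image s, v ∉ e})).Reachable u z).card ∧
            (A.filter fun z => ∃ u ∈ S.image P ∪ S.image P',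
              (openGraph (ω ∩ {e | ∀ v ∈ Finset.univ.image s, v ∉ e})).Reachable u z).card ≤ j}) +
      ∑ t, b t * ∑ S ∈ (Finset.univ : Finset (Fin M)).powerset,
        ((∏ K ∈ S, (1 - ∏ i ∈ Finset.univ.filter (fun i => cls i = K), (1 - (w s(s i, p i) : ℝ) * w s(s i, p' i)))) *
          ∏ K ∈ Finset.univ \ S, ∏ i ∈ Finset.univ.filter (fun i => cls i = K), (1 - (w s(s i, p i) : ℝ) * w s(s i, p' i))) *
        (prodBernoulli w).real {ω : BondConfig (Fin n) |
            (∀ u ∈ R t ∪ (S.image P ∪ S.image P'), ¬ (openGraph (ω ∩ {e | ∀ v ∈ Finset.univ.image s, v ∉ e})).Reachable c u) ∧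
            (A.filter fun z => (openGraph (ω ∩ {e | ∀ v ∈ Finset.univ.image s, v ∉ e})).Reachable c z).card ≤ j} := by
  -- star-level facts
  have hpA : ∀ i, p i ∈ A := fun i => (hP i) ▸ hPA (cls i)
  have hp'A : ∀ i, p' i ∈ A := fun i => (hP' i) ▸ hP'A (cls i)
  have hpp' : ∀ i, p i ≠ p' i := fun i => by rw [hP i, hP' i]; exact hPP' (cls i)
  have hps : ∀ i k, p i ≠ s k := fun i k h => hsA k (h ▸ hpA i)
  have hp's : ∀ i k, p' i ≠ s k := fun i k h => hsA k (h ▸ hp'A i)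
  have hcs : ∀ i, c ≠ s i := fun i h => hsA i (h ▸ hcA)
  -- weights
  set θ : Fin m → ℝ := fun i => (w s(s i, p i) : ℝ) * w s(s i, p' i) with hθ
  set uu : Fin M → ℝ := fun K => ∏ i ∈ Finset.univ.filter (fun i => cls i = K), (1 - θ i) with huu
  set W : Finset (Fin M) → ℝ := fun S => (∏ K ∈ S, (1 - uu K)) * ∏ K ∈ Finset.univ \ S, uu K with hW
  set D : Fin M → ℝ := fun K => (1 - uu K) *
    ∏ K' ∈ Finset.univ.filter (fun K' => ¬ (P K' = P K ∨ P K' = P' K ∨ P' K' = P K ∨ P' K' = P' K)), uu K' with hD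
  have hθ0 : ∀ i, 0 ≤ θ i := fun i => mul_nonneg (w _).2.1 (w _).2.1
  have hθ1 : ∀ i, θ i ≤ 1 := fun i => mul_le_one₀ (w _).2.2 (w _).2.1 (w _).2.2
  have huu0 : ∀ K, 0 ≤ uu K := fun K => Finset.prod_nonneg fun i _ => sub_nonneg.2 (hθ1 i)
  have huu1 : ∀ K, uu K ≤ 1 := fun K => Finset.prod_le_one (fun i _ => sub_nonneg.2 (hθ1 i)) fun i _ => sub_le_self _ (hθ0 i)
  have hDnn : ∀ K, 0 ≤ D K := fun K => mul_nonneg (sub_nonneg.2 (huu1 K)) (Finset.prod_nonneg fun K' _ => huu0 K')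
  -- the push-forward of star patterns to class patterns
  have hpush : ∀ F : Finset (Fin M) → ℝ,
      ∑ σ ∈ (Finset.univ : Finset (Fin m)).powerset, ((∏ i ∈ σ, θ i) * ∏ i ∈ Finset.univ \ σ, (1 - θ i)) * F (σ.image cls) =
        ∑ S ∈ (Finset.univ : Finset (Fin M)).powerset, W S * F S := fun F => linkSum_pushforward θ cls F
  -- events
  set ξ : BondConfig (Fin n) → BondConfig (Fin n) := fun ω => ω ∩ {e | ∀ v ∈ Finset.univ.image s, v ∉ e} with hξ
  set RK : Fin M → Finset (Fin n) := fun K => ({K} : Finset (Fin M)).image P ∪ ({K} : Finset (Fin M)).image P' with hRK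
  set ρ : Fin M → Finset (Fin M) → Set (BondConfig (Fin n)) := fun K S => {ω' |
    (∀ u ∈ RK K, ¬ (openGraph ((ω' ∩ {e | ∀ v ∈ Finset.univ.image s, v ∉ e}) ∪ ↑(S.image fun I => (s(P I, P' I) : Sym2 (Fin n))))).Reachable c u) ∧
    (A.filter fun z => (openGraph ((ω' ∩ {e | ∀ v ∈ Finset.univ.image s, v ∉ e}) ∪
      ↑(S.image fun I => (s(P I, P' I) : Sym2 (Fin n))))).Reachable c z).card ≤ j} with hρ
  set ℓ : Fin M → Finset (Fin M) → Set (BondConfig (Fin n)) := fun K S => {ω' |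
    (∀ u ∈ RK K, ¬ (openGraph ((ω' ∩ {e | ∀ v ∈ Finset.univ.image s, v ∉ e}) ∪ ↑(S.image fun I => (s(P I, P' I) : Sym2 (Fin n))))).Reachable c u) ∧
    1 ≤ (A.filter fun z => ∃ u ∈ RK K,
      (openGraph ((ω' ∩ {e | ∀ v ∈ Finset.univ.image s, v ∉ e}) ∪ ↑(S.image fun I => (s(P I, P' I) : Sym2 (Fin n))))).Reachable u z).card ∧
    (A.filter fun z => ∃ u ∈ RK K,
      (openGraph ((ω' ∩ {e | ∀ v ∈ Finset.univ.image s, v ∉ e}) ∪ ↑(S.image fun I => (s(P I, P' I) : Sym2 (Fin n))))).Reachable u z).card ≤ j}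
    with hℓ
  set D₁ : Finset (Fin M) → Set (BondConfig (Fin n)) := fun S => {ω' |
    (∀ u ∈ S.image P ∪ S.image P', ¬ (openGraph (ω' ∩ {e | ∀ v ∈ Finset.univ.image s, v ∉ e})).Reachable c u) ∧
      (A.filter fun z => (openGraph (ω' ∩ {e | ∀ v ∈ Finset.univ.image s, v ∉ e})).Reachable c z).card ≤ j} with hD₁
  set D₂ : Finset (Fin M) → Set (BondConfig (Fin n)) := fun S => {ω' |
    (∀ u ∈ S.image P ∪ S.image P', ¬ (openGraph (ω' ∩ {e | ∀ v ∈ Finset.univ.image s, v ∉ e})).Reachable c u) ∧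
      1 ≤ (A.filter fun z => ∃ u ∈ S.image P ∪ S.image P',
        (openGraph (ω' ∩ {e | ∀ v ∈ Finset.univ.image s, v ∉ e})).Reachable u z).card ∧
      (A.filter fun z => ∃ u ∈ S.image P ∪ S.image P',
        (openGraph (ω' ∩ {e | ∀ v ∈ Finset.univ.image s, v ∉ e})).Reachable u z).card ≤ j} with hD₂
  set B : ι → Finset (Fin M) → Set (BondConfig (Fin n)) := fun t S => {ω' |
    (∀ u ∈ R t ∪ (S.image P ∪ S.image P'), ¬ (openGraph (ω' ∩ {e | ∀ v ∈ Finset.univ.image s, v ∉ e})).Reachable c u) ∧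
      (A.filter fun z => (openGraph (ω' ∩ {e | ∀ v ∈ Finset.univ.image s, v ∉ e})).Reachable c z).card ≤ j} with hB
  set PS : Finset (Finset (Fin M)) := (Finset.univ : Finset (Fin M)).powerset with hPS
  change 0 ≤ C0 * ∑ S ∈ PS, W S * ((prodBernoulli w).real (D₁ S) - (prodBernoulli w).real (D₂ S)) +
    ∑ t, b t * ∑ S ∈ PS, W S * (prodBernoulli w).real (B t S)
  -- (1) the pointwise certificate
  have hpt : ∀ ω : BondConfig (Fin n),
      C0 * ∑ K, D K * ∑ S ∈ PS, W S * (DecisionTree.ind (ρ K S) ω - DecisionTree.ind (ℓ K S) ω) ≤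
        C0 * ∑ S ∈ PS, W S * (DecisionTree.ind (D₁ S) ω - DecisionTree.ind (D₂ S) ω) +
          ∑ t, b t * ∑ S ∈ PS, W S * DecisionTree.ind (B t S) ω :=
    fun ω => pairRow_certificate_pointwise w A s p p' cls P P' c j hj hPA hP'A hPP' hnopar hcA hcP C0 hC0 b hb R hRport hG0 hG1 ω
  -- (2) integrate
  have hwt0 : ∀ e : Sym2 (Fin n), 0 ≤ ((w e : unitInterval) : ℝ) := fun e => (w e).2.1
  have hwt1 : ∀ e : Sym2 (Fin n), ((w e : unitInterval) : ℝ) ≤ 1 := fun e => (w e).2.2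
  have hupper : C0 * ∑ S ∈ PS, W S * ((prodBernoulli w).real (D₁ S) - (prodBernoulli w).real (D₂ S)) +
      ∑ t, b t * ∑ S ∈ PS, W S * (prodBernoulli w).real (B t S) =
      ∑ ω : BondConfig (Fin n), BHK2006.weight (fun e => (w e : ℝ)) ω *
        (C0 * ∑ S ∈ PS, W S * (DecisionTree.ind (D₁ S) ω - DecisionTree.ind (D₂ S) ω) +
          ∑ t, b t * ∑ S ∈ PS, W S * DecisionTree.ind (B t S) ω) := by
    have e1 : C0 * ∑ S ∈ PS, W S * ((prodBernoulli w).real (D₁ S) - (prodBernoulli w).real (D₂ S)) =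
        ∑ ω : BondConfig (Fin n), BHK2006.weight (fun e => (w e : ℝ)) ω *
          (C0 * ∑ S ∈ PS, W S * (DecisionTree.ind (D₁ S) ω - DecisionTree.ind (D₂ S) ω)) := by
      rw [linkSum_real_sub_eq_sum w W D₁ D₂, Finset.mul_sum]
      exact Finset.sum_congr rfl fun ω _ => by ring
    have e2 : ∀ t, b t * ∑ S ∈ PS, W S * (prodBernoulli w).real (B t S) =
        ∑ ω : BondConfig (Fin n), BHK2006.weight (fun e => (w e : ℝ)) ω * (b t * ∑ S ∈ PS, W S * DecisionTree.ind (B t S) ω) := by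
      intro t
      rw [linkSum_real_eq_sum w W (B t), Finset.mul_sum]
      exact Finset.sum_congr rfl fun ω _ => by ring
    rw [e1, Finset.sum_congr rfl fun t _ => e2 t, Finset.sum_comm, ← Finset.sum_add_distrib]
    refine Finset.sum_congr rfl fun ω _ => ?_
    rw [← Finset.mul_sum, ← mul_add]
  have hlower : C0 * ∑ K, D K * ∑ S ∈ PS, W S * ((prodBernoulli w).real (ρ K S) - (prodBernoulli w).real (ℓ K S)) =
      ∑ ω : BondConfig (Fin n), BHK2006.weight (fun e => (w e : ℝ)) ω *
        (C0 * ∑ K, D K * ∑ S ∈ PS, W S * (DecisionTree.ind (ρ K S) ω - DecisionTree.ind (ℓ K S) ω)) := by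
    have e3 : ∀ K, D K * ∑ S ∈ PS, W S * ((prodBernoulli w).real (ρ K S) - (prodBernoulli w).real (ℓ K S)) =
        ∑ ω : BondConfig (Fin n), BHK2006.weight (fun e => (w e : ℝ)) ω *
          (D K * ∑ S ∈ PS, W S * (DecisionTree.ind (ρ K S) ω - DecisionTree.ind (ℓ K S) ω)) := by
      intro K
      rw [linkSum_real_sub_eq_sum w W (ρ K) (ℓ K), Finset.mul_sum]
      exact Finset.sum_congr rfl fun ω _ => by ring
    rw [Finset.sum_congr rfl fun K _ => e3 K, Finset.sum_comm, Finset.mul_sum]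
    refine Finset.sum_congr rfl fun ω _ => ?_
    rw [← Finset.mul_sum]
    ring
  have hint : C0 * ∑ K, D K * ∑ S ∈ PS, W S * ((prodBernoulli w).real (ρ K S) - (prodBernoulli w).real (ℓ K S)) ≤
      C0 * ∑ S ∈ PS, W S * ((prodBernoulli w).real (D₁ S) - (prodBernoulli w).real (D₂ S)) +
        ∑ t, b t * ∑ S ∈ PS, W S * (prodBernoulli w).real (B t S) := by
    rw [hupper, hlower]
    exact Finset.sum_le_sum fun ω _ => mul_le_mul_of_nonneg_left (hpt ω) (BHK2006.weight_nonneg hwt0 hwt1 ω)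
  -- (3) each pair row has nonnegative expectation (lonelier member `P K`, in the glued graphs)
  have hrow : ∀ K, 0 ≤ ∑ S ∈ PS, W S * ((prodBernoulli w).real (ρ K S) - (prodBernoulli w).real (ℓ K S)) := by
    intro K
    have hRs : ∀ u ∈ RK K, ∀ i, u ≠ s i := by
      intro u hu i
      simp only [hRK, Finset.image_singleton, Finset.mem_union, Finset.mem_singleton] at hu
      rcases hu with rfl | rfl
      · exact fun h => hsA i (h ▸ hPA K)
      · exact fun h => hsA i (h ▸ hP'A K)
    have hy : P K ∈ RK K := by simp [hRK]
    have h := linkRow_le w A s p p' (RK K) (P K) c j hs hps hp's hpp' hwjunk hsA hRs hcs hy (hdom K)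
    -- push forward to class patterns
    have hℓσ : ∀ σ : Finset (Fin m), (prodBernoulli w).real (ℓ K (σ.image cls)) =
        (prodBernoulli w).real {ω : BondConfig (Fin n) |
          (∀ u ∈ RK K, ¬ (openGraph ((ω ∩ {e | ∀ v ∈ Finset.univ.image s, v ∉ e}) ∪
            ↑(σ.image fun i => (s(p i, p' i) : Sym2 (Fin n))))).Reachable c u) ∧
          1 ≤ (A.filter fun z => ∃ u ∈ RK K, (openGraph ((ω ∩ {e | ∀ v ∈ Finset.univ.image s, v ∉ e}) ∪
            ↑(σ.image fun i => (s(p i, p' i) : Sym2 (Fin n))))).Reachable u z).card ∧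
          (A.filter fun z => ∃ u ∈ RK K, (openGraph ((ω ∩ {e | ∀ v ∈ Finset.univ.image s, v ∉ e}) ∪
            ↑(σ.image fun i => (s(p i, p' i) : Sym2 (Fin n))))).Reachable u z).card ≤ j} := by
      intro σ; simp only [hℓ]; rw [linkPattern_eq_classPattern p p' cls P P' hP hP' σ]
    have hρσ : ∀ σ : Finset (Fin m), (prodBernoulli w).real (ρ K (σ.image cls)) =
        (prodBernoulli w).real {ω : BondConfig (Fin n) |
          (∀ u ∈ RK K, ¬ (openGraph ((ω ∩ {e | ∀ v ∈ Finset.univ.image s, v ∉ e}) ∪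
            ↑(σ.image fun i => (s(p i, p' i) : Sym2 (Fin n))))).Reachable c u) ∧
          (A.filter fun z => (openGraph ((ω ∩ {e | ∀ v ∈ Finset.univ.image s, v ∉ e}) ∪
            ↑(σ.image fun i => (s(p i, p' i) : Sym2 (Fin n))))).Reachable c z).card ≤ j} := by
      intro σ; simp only [hρ]; rw [linkPattern_eq_classPattern p p' cls P P' hP hP' σ]
    have hL : ∑ S ∈ PS, W S * (prodBernoulli w).real (ℓ K S) =
        ∑ σ ∈ (Finset.univ : Finset (Fin m)).powerset, ((∏ i ∈ σ, θ i) * ∏ i ∈ Finset.univ \ σ, (1 - θ i)) *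
          (prodBernoulli w).real (ℓ K (σ.image cls)) := (hpush (fun S => (prodBernoulli w).real (ℓ K S))).symm
    have hR : ∑ S ∈ PS, W S * (prodBernoulli w).real (ρ K S) =
        ∑ σ ∈ (Finset.univ : Finset (Fin m)).powerset, ((∏ i ∈ σ, θ i) * ∏ i ∈ Finset.univ \ σ, (1 - θ i)) *
          (prodBernoulli w).real (ρ K (σ.image cls)) := (hpush (fun S => (prodBernoulli w).real (ρ K S))).symm
    have hsplit : ∑ S ∈ PS, W S * ((prodBernoulli w).real (ρ K S) - (prodBernoulli w).real (ℓ K S)) =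
        ∑ S ∈ PS, W S * (prodBernoulli w).real (ρ K S) - ∑ S ∈ PS, W S * (prodBernoulli w).real (ℓ K S) := by
      rw [← Finset.sum_sub_distrib]; exact Finset.sum_congr rfl fun S _ => by ring
    have hL' := hL.trans (Finset.sum_congr rfl fun σ _ => by rw [hℓσ σ])
    have hR' := hR.trans (Finset.sum_congr rfl fun σ _ => by rw [hρσ σ])
    rw [hsplit, hL', hR']
    exact sub_nonneg.2 h
  have hlb : 0 ≤ C0 * ∑ K, D K * ∑ S ∈ PS, W S * ((prodBernoulli w).real (ρ K S) - (prodBernoulli w).real (ℓ K S)) :=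
    mul_nonneg hC0 (Finset.sum_nonneg fun K _ => mul_nonneg (hDnn K) (hrow K))
  exact le_trans hlb hint

end StarSet

end Summit.CriticalPhenomena.PercolationContinuityZ3.Theorems

end
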